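import Literature.Geometry.Lorentzian.VolumeChartIntegral
import Literature.Geometry.Riemannian.CanonicalNeighbourhoods
import Mathlib.MeasureTheory.Function.Jacobian
import Mathlib.MeasureTheory.Constructions.Polish.Basic
import HarnessLib

/-!
# The area formula for an injective `C¹` map into a Riemannian manifold

Let `(M, g)` be a Riemannian `m`-manifold modelled on `ℝᵐ = EuclideanSpace ℝ (Fin m)` (a smooth
`PseudoRiemannianMetric g` on `TM` with `g.IsRiemannian`), `F : ℝᵐ → M` a `C¹` map and
`S ⊆ ℝᵐ` a measurable set on which `F` is injective. Then

  `Vol_g (F '' S) = ∫_S 𝒥_F(u) du`,                    (`riemVolume_image_eq_lintegral_jacobian`)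

where `Vol_g = g.riemVolume` is the Riemannian measure (the Euclidean-normalised `m`-dimensional
Hausdorff measure of the length metric, `Literature/Geometry/Lorentzian/Volume.lean`,
`Literature/Geometry/Riemannian/CanonicalNeighbourhoods.lean`) and
`𝒥_F(u) = √(det (g_{F u}(dF_u eᵢ, dF_u eⱼ))ᵢⱼ)` is the Gram–Jacobian of `F` in the standard basis
`eᵢ = EuclideanSpace.single i 1`. This is the area formula of Federer, *Geometric Measure Theory*
(1969), §3.2.3 (maps `ℝᵐ → ℝⁿ`) and §3.2.46 (maps into Riemannian manifolds), in the injective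
case (multiplicity one); Chavel, *Riemannian Geometry* (2006), §III.3. It is used with
`F = exp_x` on a domain of injectivity (Bishop–Gromov volume comparison by polar coordinates).

The pointwise identification of the Gram–Jacobian with the chart expression,
`𝒥_F(u) = |det D(φ_q ∘ F)(u)| · √(det h_{ij}(φ_q (F u)))` for the extended chart `φ_q` at any
`q` with `F u ∈ φ_q.source` (`h_{ij} = chartGramMatrix`), is taken as the hypothesis `hJac`
(it is pure linear algebra: both sides are `√(det (Aᵀ G A))` for `A = D(φ_q ∘ F)(u)`); it is
proved separately in this directory.

## Proof

* One chart (`riemVolume_image_eq_lintegral_jacobian_of_mapsTo`): if `F '' T ⊆ φ.source` for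
  the extended chart `φ` at `q`, then `F '' T` is measurable (Lusin–Souslin,
  `MeasurableSet.image_of_continuousOn_injOn`: `ℝᵐ` is Polish and `F` is continuous and injective
  on `T`), so the chart formula on sets (`riemannianMeasure_eq_integral_sqrt_det_holds`) gives
  `Vol_g(F '' T) = ∫_{(φ ∘ F) '' T} √(det h_{ij}) dy`; the Euclidean change of variables
  (`MeasureTheory.lintegral_image_eq_lintegral_abs_det_fderiv_mul`) for the injective `C¹` map
  `φ ∘ F : ℝᵐ → ℝᵐ` on `T` turns this into `∫_T |det D(φ ∘ F)| √(det h_{ij}) ∘ (φ ∘ F)`, which is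
  `∫_T 𝒥_F` by `hJac`.
* Globalisation: `M` is second countable, so countably many chart domains `φ_{q_k}.source` cover
  `M`; the sets `S ∩ F⁻¹(φ_{q_k}.source)` are made pairwise disjoint (`disjointed`), their images
  are pairwise disjoint by injectivity, and both sides are countably additive
  (`measure_iUnion`, `lintegral_iUnion`).

No definitions and no named facts are introduced.

## References

* H. Federer, *Geometric Measure Theory*, Springer 1969, §3.2.3, §3.2.5, §3.2.46. [Federer1969]
* I. Chavel, *Riemannian Geometry: A Modern Introduction*, 2nd ed., CUP 2006, §III.3
  (Riemannian measure in coordinates, (III.3.5)–(III.3.6)). [Chavel2006]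
-/

noncomputable section

open Bundle Set Function Filter MeasureTheory Manifold
open scoped Manifold ContDiff Topology ENNReal NNReal

namespace Literature.Geometry.Riemannian

open Lorentzian Lorentzian.PseudoRiemannianMetric

/-! ### A `C¹` map into `M` read in a chart is differentiable -/

section Chart

variable {m : ℕ} {M : Type*} [TopologicalSpace M] [ChartedSpace (EuclideanSpace ℝ (Fin m)) M]
  [IsManifold (𝓡 m) 1 M]

/-- If `F : ℝᵐ → M` is `C¹` at `u` (as a map of manifolds) and `F u` lies in the domain of the
extended chart `φ` at `q`, then `φ ∘ F : ℝᵐ → ℝᵐ` is differentiable at `u` (the chart is `C¹` on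
its domain, and `C¹` maps between vector spaces are differentiable). [folklore] -/
theorem differentiableAt_extChartAt_comp {F : EuclideanSpace ℝ (Fin m) → M}
    {u : EuclideanSpace ℝ (Fin m)}
    (hF : ContMDiffAt 𝓘(ℝ, EuclideanSpace ℝ (Fin m)) (𝓡 m) 1 F u) (q : M)
    (hq : F u ∈ (extChartAt (𝓡 m) q).source) :
    DifferentiableAt ℝ ((extChartAt (𝓡 m) q) ∘ F) u := by
  have h1 : ContMDiffAt (𝓡 m) 𝓘(ℝ, EuclideanSpace ℝ (Fin m)) 1 (extChartAt (𝓡 m) q) (F u) :=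
    contMDiffAt_extChartAt' (by rwa [← extChartAt_source (𝓡 m)])
  exact (contMDiffAt_iff_contDiffAt.1 (h1.comp u hF)).differentiableAt one_ne_zero

omit [IsManifold (𝓡 m) 1 M] in
/-- If `F` is injective on `T` and maps `T` into the domain of the extended chart `φ` at `q`,
then `φ ∘ F` is injective on `T` (the chart is injective on its domain). [folklore] -/
theorem injOn_extChartAt_comp {F : EuclideanSpace ℝ (Fin m) → M}
    {T : Set (EuclideanSpace ℝ (Fin m))} (hinj : InjOn F T) (q : M)
    (hT : MapsTo F T (extChartAt (𝓡 m) q).source) :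
    InjOn ((extChartAt (𝓡 m) q) ∘ F) T := fun _ hu _ hv huv ↦
  hinj hu hv ((extChartAt (𝓡 m) q).injOn (hT hu) (hT hv) huv)

end Chart

/-! ### The area formula -/

section AreaFormula

variable {m : ℕ} {M : Type*} [TopologicalSpace M] [T2Space M] [SecondCountableTopology M]
  [ChartedSpace (EuclideanSpace ℝ (Fin m)) M] [IsManifold (𝓡 m) ∞ M]
  [T3Space M] [MeasurableSpace M] [BorelSpace M]
  (g : PseudoRiemannianMetric (𝓡 m) ∞ (EuclideanSpace ℝ (Fin m)) (TangentSpace (𝓡 m) : M → Type _))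

omit [SecondCountableTopology M] [IsManifold (𝓡 m) ∞ M] [T3Space M] in
/-- **Images of measurable sets under injective `C¹` maps `ℝᵐ → M` are measurable**
(Lusin–Souslin: `ℝᵐ` is Polish, `F` is continuous and injective on the Borel set `T`, `M` is
Hausdorff). [folklore] -/
theorem measurableSet_image_of_contMDiff_injOn {F : EuclideanSpace ℝ (Fin m) → M}
    (hF : ContMDiff 𝓘(ℝ, EuclideanSpace ℝ (Fin m)) (𝓡 m) 1 F)
    {T : Set (EuclideanSpace ℝ (Fin m))} (hT : MeasurableSet T) (hinj : InjOn F T) :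
    MeasurableSet (F '' T) :=
  hT.image_of_continuousOn_injOn hF.continuous.continuousOn hinj

omit [SecondCountableTopology M] in
/-- **Area formula in one chart.** Let `g` be a Riemannian metric on the `m`-manifold `M`,
`F : ℝᵐ → M` a `C¹` map, `T ⊆ ℝᵐ` measurable with `F` injective on `T` and `F '' T` inside the
domain of the extended chart `φ` at `q`. Granted the chart expression `hJac` of the Gram–Jacobian
`𝒥_F(u) = √(det g_{F u}(dF eᵢ, dF eⱼ)) = |det D(φ ∘ F)(u)| √(det h_{ij}(φ (F u)))`, one has
`Vol_g(F '' T) = ∫_T 𝒥_F`: the chart formula `Vol_g(A) = ∫_{φ A} √(det h_{ij})` for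
`A = F '' T` followed by the Euclidean change of variables along the injective `C¹` map `φ ∘ F`.
Federer 1969, §3.2.3 and §3.2.46; Chavel 2006, §III.3. [cite: Federer1969, §3.2.3 and §3.2.46] -/
theorem riemVolume_image_eq_lintegral_jacobian_of_mapsTo (hg : g.IsRiemannian)
    {F : EuclideanSpace ℝ (Fin m) → M} (hF : ContMDiff 𝓘(ℝ, EuclideanSpace ℝ (Fin m)) (𝓡 m) 1 F)
    (hJac : ∀ (u : EuclideanSpace ℝ (Fin m)) (q : M), F u ∈ (extChartAt (𝓡 m) q).source →
      Real.sqrt (Matrix.det (Matrix.of fun i j : Fin m ↦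
        g.val (F u) (mfderiv 𝓘(ℝ, EuclideanSpace ℝ (Fin m)) (𝓡 m) F u (EuclideanSpace.single i (1 : ℝ)))
          (mfderiv 𝓘(ℝ, EuclideanSpace ℝ (Fin m)) (𝓡 m) F u (EuclideanSpace.single j (1 : ℝ))))) =
      |(fderiv ℝ ((extChartAt (𝓡 m) q) ∘ F) u).det| *
        Real.sqrt (Matrix.det (chartGramMatrix (g.toContMDiffRiemannianMetric hg) q
          ((extChartAt (𝓡 m) q) (F u)))))
    {T : Set (EuclideanSpace ℝ (Fin m))} (hT : MeasurableSet T) (hinj : InjOn F T) (q : M)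
    (hTq : MapsTo F T (extChartAt (𝓡 m) q).source) :
    g.riemVolume (F '' T) = ∫⁻ u in T, ENNReal.ofReal (Real.sqrt (Matrix.det (Matrix.of fun i j : Fin m ↦
      g.val (F u) (mfderiv 𝓘(ℝ, EuclideanSpace ℝ (Fin m)) (𝓡 m) F u (EuclideanSpace.single i (1 : ℝ)))
        (mfderiv 𝓘(ℝ, EuclideanSpace ℝ (Fin m)) (𝓡 m) F u (EuclideanSpace.single j (1 : ℝ)))))) := by
  have hmeas : MeasurableSet (F '' T) := measurableSet_image_of_contMDiff_injOn hF hT hinj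
  rw [riemVolume_eq hg, riemannianMeasure_eq_integral_sqrt_det_holds (g.toContMDiffRiemannianMetric hg)
    q hmeas hTq.image_subset, ← image_comp]
  have hderiv : ∀ u ∈ T, HasFDerivWithinAt ((extChartAt (𝓡 m) q) ∘ F)
      (fderiv ℝ ((extChartAt (𝓡 m) q) ∘ F) u) T u := fun u hu ↦
    (differentiableAt_extChartAt_comp (hF u) q (hTq hu)).hasFDerivAt.hasFDerivWithinAt
  rw [lintegral_image_eq_lintegral_abs_det_fderiv_mul volume hT hderiv
    (injOn_extChartAt_comp hinj q hTq)]
  refine setLIntegral_congr_fun hT (fun u hu ↦ ?_)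
  rw [hJac u q (hTq hu), ENNReal.ofReal_mul (abs_nonneg _)]
  rfl

/-- **The area formula for an injective `C¹` map into a Riemannian manifold.** Let `g` be a
Riemannian metric on the `m`-manifold `M` (modelled on `ℝᵐ`, second countable), `F : ℝᵐ → M` a
`C¹` map and `S ⊆ ℝᵐ` a measurable set on which `F` is injective. Granted the chart expression
`hJac` of the Gram–Jacobian `𝒥_F(u) = √(det g_{F u}(dF_u eᵢ, dF_u eⱼ))`, namely
`𝒥_F(u) = |det D(φ_q ∘ F)(u)| √(det h_{ij}(φ_q (F u)))` in every extended chart `φ_q` whose domain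
contains `F u`, the Riemannian volume of the image is the integral of the Gram–Jacobian:
`Vol_g(F '' S) = ∫_S 𝒥_F(u) du`. Federer 1969, §3.2.3 (area formula, multiplicity one for
injective maps) and §3.2.46 (Riemannian targets); Chavel 2006, §III.3. Proof: countably many
chart domains cover `M`; on the disjointified pieces of `S` the one-chart formula
`riemVolume_image_eq_lintegral_jacobian_of_mapsTo` applies, the images of the pieces are pairwise
disjoint by injectivity and measurable by Lusin–Souslin, and both sides are countably additive.
[cite: Federer1969, §3.2.3 and §3.2.46] -/
theorem riemVolume_image_eq_lintegral_jacobian (hg : g.IsRiemannian)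
    {F : EuclideanSpace ℝ (Fin m) → M} (hF : ContMDiff 𝓘(ℝ, EuclideanSpace ℝ (Fin m)) (𝓡 m) 1 F)
    (hJac : ∀ (u : EuclideanSpace ℝ (Fin m)) (q : M), F u ∈ (extChartAt (𝓡 m) q).source →
      Real.sqrt (Matrix.det (Matrix.of fun i j : Fin m ↦
        g.val (F u) (mfderiv 𝓘(ℝ, EuclideanSpace ℝ (Fin m)) (𝓡 m) F u (EuclideanSpace.single i (1 : ℝ)))
          (mfderiv 𝓘(ℝ, EuclideanSpace ℝ (Fin m)) (𝓡 m) F u (EuclideanSpace.single j (1 : ℝ))))) =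
      |(fderiv ℝ ((extChartAt (𝓡 m) q) ∘ F) u).det| *
        Real.sqrt (Matrix.det (chartGramMatrix (g.toContMDiffRiemannianMetric hg) q
          ((extChartAt (𝓡 m) q) (F u)))))
    {S : Set (EuclideanSpace ℝ (Fin m))} (hS : MeasurableSet S) (hinj : InjOn F S) :
    g.riemVolume (F '' S) = ∫⁻ u in S, ENNReal.ofReal (Real.sqrt (Matrix.det (Matrix.of fun i j : Fin m ↦
      g.val (F u) (mfderiv 𝓘(ℝ, EuclideanSpace ℝ (Fin m)) (𝓡 m) F u (EuclideanSpace.single i (1 : ℝ)))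
        (mfderiv 𝓘(ℝ, EuclideanSpace ℝ (Fin m)) (𝓡 m) F u (EuclideanSpace.single j (1 : ℝ)))))) := by
  -- a countable family of chart domains covering `M`, indexed by `ℕ`
  obtain ⟨t, htc, ht⟩ := TopologicalSpace.countable_cover_nhds
    (fun x : M ↦ extChartAt_source_mem_nhds (I := 𝓡 m) x)
  have hmem : ∀ p : M, p ∈ ⋃ x ∈ t, (extChartAt (𝓡 m) x).source := fun p ↦ by
    rw [ht]; exact mem_univ p
  have htne : t.Nonempty := by
    obtain ⟨x, hx, -⟩ := mem_iUnion₂.1 (hmem (F 0))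
    exact ⟨x, hx⟩
  obtain ⟨qs, hqs⟩ := htc.exists_eq_range htne
  have hcover : ∀ p : M, ∃ k, p ∈ (extChartAt (𝓡 m) (qs k)).source := fun p ↦ by
    have hp := hmem p
    rw [hqs, biUnion_range] at hp
    exact mem_iUnion.1 hp
  -- the disjointified pieces of `S`
  set A : ℕ → Set (EuclideanSpace ℝ (Fin m)) :=
    fun k ↦ S ∩ F ⁻¹' (extChartAt (𝓡 m) (qs k)).source with hA
  have hAmeas : ∀ k, MeasurableSet (A k) := fun k ↦
    hS.inter ((isOpen_extChartAt_source (qs k)).preimage hF.continuous).measurableSet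
  have hPmeas : ∀ k, MeasurableSet (disjointed A k) := MeasurableSet.disjointed hAmeas
  have hPS : ∀ k, disjointed A k ⊆ S := fun k ↦ (disjointed_subset A k).trans inter_subset_left
  have hPq : ∀ k, MapsTo F (disjointed A k) (extChartAt (𝓡 m) (qs k)).source := fun k u hu ↦
    (disjointed_subset A k hu).2
  have hSU : ⋃ k, disjointed A k = S := by
    rw [iUnion_disjointed]
    refine subset_antisymm (iUnion_subset fun k ↦ inter_subset_left) (fun u hu ↦ ?_)
    obtain ⟨k, hk⟩ := hcover (F u)
    exact mem_iUnion.2 ⟨k, hu, hk⟩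
  have hdisj : Pairwise (Disjoint on disjointed A) := disjoint_disjointed A
  have hdisj' : Pairwise (Disjoint on fun k ↦ F '' disjointed A k) := fun k l hkl ↦
    (hdisj hkl).image hinj (hPS k) (hPS l)
  have hmeas' : ∀ k, MeasurableSet (F '' disjointed A k) := fun k ↦
    measurableSet_image_of_contMDiff_injOn hF (hPmeas k) (hinj.mono (hPS k))
  rw [← hSU, image_iUnion, measure_iUnion hdisj' hmeas', lintegral_iUnion hPmeas hdisj]
  exact tsum_congr fun k ↦ riemVolume_image_eq_lintegral_jacobian_of_mapsTo g hg hF hJac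
    (hPmeas k) (hinj.mono (hPS k)) (qs k) (hPq k)

end AreaFormula

end Literature.Geometry.Riemannian

end
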